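import Mathlib
import Summits.ValiantsHypothesis.ValiantsHypothesis.Theorems.KPlusLogSqLawTropicalCensusRows
import Summits.ValiantsHypothesis.ValiantsHypothesis.Theorems.MatrixDescartes.Negative.MatrixDescartesFalseOfTropicalMonster

/-!
# The tridiagonal sector is Descartes-SHARP at format `(3,3)`: a symmetric tridiagonal 3×3 three-term pencil with 9 positive zeros

HONEST FRAMING.  Helper datum for the desk's «sector-B on the tridiagonal (symmetric Hessenberg) sector» docket (lead R1423 (2)(α);
registered stubs `stub_tridiagonalSectorB` / `stub_tridiagonalSectorBDiag` on `WeakLifting` = stmt-ValiantsHypothesis-19561, route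
`KPlusLogSqLaw`, cell `pub-symmetroid`; seat val-sym-lift-p2 g3, 2026-08-26): the SMALLEST INFORMATIVE INSTANCE asked for by the desk,
in the only currency a finite computation can reach.  It is a FIXED-FORMAT statement (zero (iv)/W1 credit) and proves nothing about the
sector law in the window, about `WeakLifting`, `TropicalB`, Conjecture B, `MatrixDescartes` (stmt-ValiantsHypothesis-18050), the DoorA
registers or VP ≠ VNP.

WHAT IS PROVED.  A SYMMETRIC TRIDIAGONAL tropical design of format `(3,3)` (exponents `(0,1,4)`; valuations and signs symmetric in the
entry indices, the corner entries `(0,2)`, `(2,0)` ABSENT) whose ten class histograms are all realised, in slope order, as unique optima at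
the integer slopes `Th`, with alternating term signs (dominance by `decide` through the tree's dual certificate
`isDominant_of_scaledPotential`, scale `S = 4`; as a bare tropical row this is the tree's `census_three_three_bound`, so no separate
tropical theorem is stated); the optima use the transpositions `(0 1)` and
`(1 2)` (continuant terms `b₁²·a₃`, `b₂²·a₁`), not only the diagonal.  By Viro patchworking at base `b = 163 > 3!·3³` (the tree's
`det_patch_alternates`) its patchworked pencil `Σ_l X^{d_l} · patchMatrix 163 V E l` is a real SYMMETRIC TRIDIAGONAL `3 × 3` three-term
pencil with at least `9 = C(5,3) − 1` distinct positive determinant zeros (`exists_symm_tridiagonal_pencil_nine`), i.e. the Descartes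
ceiling of the format: **tridiagonality gives NO sub-Descartes saving at `(3,3)`** (`not_tridiagonalPosRootLaw_three_three_eight`, stated
with the stub's tridiagonality predicate).  The additive heuristic `(3m−2)(K−1) = 14` of conjb-2's `TridiagonalAdditiveLaw` is NOT tested
here (`14 > 9`); the first formats where it binds are `(2,7)`, `(3,5)`, `(4,4)`.  Design found by a hub-light exact-hull hill climb
(seconds); certificate potentials by Bellman–Ford on the assignment dual, all re-verified by brute force over the `6·27` terms.
[folklore] LP duality / Viro patchworking; data of this seat.
-/

set_option linter.dupNamespace false
set_option autoImplicit false

namespace Summit.ValiantsHypothesis.ValiantsHypothesis.Theorems.KPlusLogSqLaw.TridiagonalSector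

open Summit.ValiantsHypothesis.ValiantsHypothesis.Theorems.MatrixDescartes.Negative
open Summit.ValiantsHypothesis.ValiantsHypothesis.Theorems.LacunarySymmetroidMatrixDescartes.TropicalCensus
open Polynomial Finset

/-- **A real SYMMETRIC TRIDIAGONAL `3 × 3` three-term pencil with `9` distinct positive determinant zeros** (Viro patchworking of the
same design at base `163 > 3!·3³`, coefficient matrices `patchMatrix 163 V E l`): the Descartes ceiling `C(5,3) − 1 = 9` of the format
`(3,3)` is attained INSIDE the tridiagonal sector. [folklore patchworking; data of this seat] -/
theorem exists_symm_tridiagonal_pencil_nine :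
    ∃ (d : Fin 3 → ℕ) (S : Fin 3 → Matrix (Fin 3) (Fin 3) ℝ), (∀ l, (S l).IsSymm) ∧
      (∀ l (i j : Fin 3), (i : ℕ) + 1 < j ∨ (j : ℕ) + 1 < i → S l i j = 0) ∧
      9 ≤ ((∑ l, (X : ℝ[X]) ^ d l • (S l).map C).det.roots.toFinset.filter (fun t => 0 < t)).card := by
  let D : Fin 3 → ℕ := ![0, 1, 4]
  let V : Fin 3 → Fin 3 → Fin 3 → ℤ :=
    ![![![104, 62, 96], ![32, 34, 240], ![0, 0, 0]],
      ![![32, 34, 240], ![0, 52, 212], ![286, 24, 152]],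
      ![![0, 0, 0], ![286, 24, 152], ![300, 160, 6]]]
  let E : Fin 3 → Fin 3 → Fin 3 → ℤ :=
    ![![![1, (-1 : ℤ), (-1 : ℤ)], ![1, 1, 1], ![0, 0, 0]],
      ![![1, 1, 1], ![(-1 : ℤ), 1, (-1 : ℤ)], ![1, 1, 1]],
      ![![0, 0, 0], ![1, 1, 1], ![1, (-1 : ℤ), 1]]]
  let Th : Fin 10 → ℤ := ![(-141 : ℤ), (-139 : ℤ), (-71 : ℤ), (-41 : ℤ), (-39 : ℤ), (-1 : ℤ), 7, 15, 53, 54]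
  let Sg : Fin 10 → Equiv.Perm (Fin 3) :=
    ![(Equiv.swap (0 : Fin 3) 1 : Equiv.Perm (Fin 3)), (Equiv.swap (0 : Fin 3) 1 : Equiv.Perm (Fin 3)),
      (Equiv.swap (1 : Fin 3) 2 : Equiv.Perm (Fin 3)), (Equiv.swap (1 : Fin 3) 2 : Equiv.Perm (Fin 3)),
      (Equiv.swap (0 : Fin 3) 1 : Equiv.Perm (Fin 3)), (1 : Equiv.Perm (Fin 3)),
      (Equiv.swap (0 : Fin 3) 1 : Equiv.Perm (Fin 3)), (1 : Equiv.Perm (Fin 3)), (1 : Equiv.Perm (Fin 3)), (1 : Equiv.Perm (Fin 3))]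
  let Cl : Fin 10 → Fin 3 → Fin 3 :=
    ![![(0 : Fin 3), (0 : Fin 3), (0 : Fin 3)], ![(0 : Fin 3), (0 : Fin 3), (1 : Fin 3)], ![(0 : Fin 3), (1 : Fin 3), (1 : Fin 3)],
      ![(1 : Fin 3), (1 : Fin 3), (1 : Fin 3)], ![(0 : Fin 3), (0 : Fin 3), (2 : Fin 3)], ![(1 : Fin 3), (0 : Fin 3), (2 : Fin 3)],
      ![(1 : Fin 3), (1 : Fin 3), (2 : Fin 3)], ![(2 : Fin 3), (0 : Fin 3), (2 : Fin 3)], ![(2 : Fin 3), (1 : Fin 3), (2 : Fin 3)],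
      ![(2 : Fin 3), (2 : Fin 3), (2 : Fin 3)]]
  let U : Fin 10 → Fin 3 → ℤ :=
    ![![254, 541, 0], ![258, 545, 0], ![253, 542, 0], ![133, 418, 0], ![122, 397, 0], ![0, 125, 26], ![0, 109, 41],
      ![0, 69, 34], ![73, 0, 237], ![65, 0, 241]]
  let W : Fin 10 → Fin 3 → ℤ :=
    ![![(-669 : ℤ), (-382 : ℤ), (-1200 : ℤ)], ![(-673 : ℤ), (-386 : ℤ), (-1196 : ℤ)], ![(-669 : ℤ), (-380 : ℤ), (-922 : ℤ)],
      ![(-545 : ℤ), (-260 : ℤ), (-678 : ℤ)], ![(-525 : ℤ), (-250 : ℤ), (-648 : ℤ)], ![(-252 : ℤ), (-125 : ℤ), (-66 : ℤ)],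
      ![(-217 : ℤ), (-108 : ℤ), 47], ![(-144 : ℤ), (-69 : ℤ), 182], ![391, 4, 587], ![415, 16, 599]]
  have hε : ∀ i j l, (E i j l).natAbs ≤ 1 := by decide
  have hθ : StrictMono Th := by rw [Fin.strictMono_iff_lt_succ]; decide
  have hp : ∀ k i, E (Sg k i) i (Cl k i) ≠ 0 := by decide
  have ht : ∀ k i, U k (Sg k i) + W k i = 4 * (Th k * (D (Cl k i) : ℤ) - V (Sg k i) i (Cl k i)) := by decide
  have hs : ∀ k a b l, E a b l ≠ 0 → (Sg k b ≠ a ∨ Cl k b ≠ l) → 4 * (Th k * (D l : ℤ) - V a b l) < U k a + W k b := by decide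
  have hdom : ∀ k, IsDominant D V E (Th k) (Sg k, Cl k) := fun k =>
    isDominant_of_scaledPotential D V E (Th k) (Sg k) (Cl k) 4 (by norm_num) (U k) (W k) (hp k) (ht k) (hs k)
  have halt : ∀ k : Fin 9, termSign E ((fun k => (Sg k, Cl k)) k.castSucc) * termSign E ((fun k => (Sg k, Cl k)) k.succ) < 0 := by
    decide
  have hVs : ∀ i j l, V i j l = V j i l := by decide
  have hEs : ∀ i j l, E i j l = E j i l := by decide
  have hEc : ∀ l (i j : Fin 3), (i : ℕ) + 1 < j ∨ (j : ℕ) + 1 < i → E i j l = 0 := by decide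
  set b : ℝ := 163 with hbdef
  have hcard : (Fintype.card (Equiv.Perm (Fin 3) × (Fin 3 → Fin 3)) : ℝ) < b := by
    rw [Fintype.card_prod, Fintype.card_perm, Fintype.card_fun, Fintype.card_fin]
    rw [hbdef]; norm_num [Nat.factorial]
  have hb1 : (1 : ℝ) < b := by rw [hbdef]; norm_num
  have hb0 : (0 : ℝ) < b := by rw [hbdef]; norm_num
  have hsymm : ∀ l, (patchMatrix b V E l).IsSymm := by
    intro l
    ext i j
    simp only [Matrix.transpose_apply, patchMatrix]
    rw [hVs j i l, hEs j i l]
  have htri : ∀ l (i j : Fin 3), (i : ℕ) + 1 < j ∨ (j : ℕ) + 1 < i → patchMatrix b V E l i j = 0 := by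
    intro l i j hij
    simp only [patchMatrix, hEc l i j hij, Int.cast_zero, zero_mul]
  refine ⟨D, patchMatrix b V E, hsymm, htri, ?_⟩
  let τ : Fin 10 → ℝ := fun k => b ^ Th k
  have hτmono : StrictMono τ := fun i j hij => zpow_lt_zpow_right₀ hb1 (hθ hij)
  have hτpos : ∀ k, 0 < τ k := fun k => zpow_pos hb0 _
  refine Summit.ValiantsHypothesis.ValiantsHypothesis.Theorems.SymmetroidDescartes.le_card_posRoots_of_alternating
    _ 9 τ hτmono hτpos fun k => ?_
  rw [Summit.ValiantsHypothesis.ValiantsHypothesis.Theorems.SymmetroidDescartes.eval_det_pencil,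
    Summit.ValiantsHypothesis.ValiantsHypothesis.Theorems.SymmetroidDescartes.eval_det_pencil]
  exact det_patch_alternates b D V E hε Th (fun k => (Sg k, Cl k)) hdom halt hcard k

/-- **The tridiagonal sector's positive-root row at `(3,3)` is NOT below Descartes**: it is false that every symmetric tridiagonal
`3 × 3` three-term lacunary pencil has at most `8 = C(5,3) − 2` distinct positive determinant zeros (tridiagonality predicate spelled as
in the registered stub `stub_tridiagonalSectorB`). [corollary] -/
theorem not_tridiagonalPosRootLaw_three_three_eight :
    ¬ (∀ (d : Fin 3 → ℕ) (S : Fin 3 → Matrix (Fin 3) (Fin 3) ℝ), (∀ l, (S l).IsSymm) →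
        (∀ l (i j : Fin 3), (i : ℕ) + 1 < j ∨ (j : ℕ) + 1 < i → S l i j = 0) →
        ((∑ l, (X : ℝ[X]) ^ d l • (S l).map C).det.roots.toFinset.filter (fun t => 0 < t)).card ≤ 8) := by
  intro h
  obtain ⟨d, S, hS, hT, h9⟩ := exists_symm_tridiagonal_pencil_nine
  have := h d S hS hT
  omega

end Summit.ValiantsHypothesis.ValiantsHypothesis.Theorems.KPlusLogSqLaw.TridiagonalSector
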